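import Summits.ValiantsHypothesis.ValiantsHypothesis.Theorems.LacunarySymmetroidMatrixDescartesInertiaParity
import Summits.ValiantsHypothesis.ValiantsHypothesis.Theorems.LacunarySymmetroidMatrixDescartesDefiniteMomentsZonesInterlacing

/-!
# `MatrixDescartes` census — DOOR A at `(3,4)`: the FLAG INERTIA LAW — a fully external `(odd, sign-changing)` flag at one
# end of a real symmetric `3 × 3` lacunary pencil forces a DEFINITE opposite end and a ONE-BRANCH inertia walk

HONEST FRAMING.  Object-search cell `pub-symmetroid`, seat `val-sym-door-p3` (gen 15); helper file `--supports` the OPEN typed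
statement `Theses.LacunarySymmetroid.DoorA34 = PosRootLawAt 3 4 18` (stmt-ValiantsHypothesis-19980), asserted nowhere.  General
inertia bookkeeping valid for EVERY real symmetric `3 × 3` lacunary pencil `F(x) = ∑ₖ x^{dₖ} Sₖ` (any number of letters, any
exponents); nothing here bounds `ζ_sym(3,4)`, and nothing bears on `MatrixDescartes` (stmt-ValiantsHypothesis-18050) or `VP ≠ VNP`.

WHY (the cell's FLAG LADDER, CONJECTURE.md §3 A-flag / STRUCTURE §2).  The only mechanism of record that manufactures
Descartes-extremal rows grafts a far letter onto an extremal `(3,3)` nine-row `F` through a FLAG of null compressions: a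
`19 = D(3,4)` at `(3,4)` needs an end of `F` carrying `(γ₁, γ₂) = (5, 2)` — a `2 × 2` principal compression `G = F[e,e]` whose
`det` has its `5` positive roots beyond every root of `det F`, and a diagonal entry `g` of `G` with `2` roots beyond those
(kit sweep j172323: none on the `39` certified nine-rows; PRED-T5).  This file proves what such a flag FORCES on `F` itself:

* `negIndex_eq_of_det_ne_zero_Icc` — on a closed window free of roots of `det F` the negative index `ν(F(x))` is constant
  (the two-sided window inequality `Inertia.negIndex_dist_le_sum_corank` with an empty singular set);
* `one_le_negIndex_of_diag_neg`, `negIndex_add_one_le_card_of_diag_pos` — a negative (positive) diagonal entry is a negative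
  (positive) Rayleigh vector (`Inertia.card_le_negIndex` / `card_le_posIndex` with a one-member family);
* **`flag_inertia_law`** — let `0 < a < X₁ < X₂ ≤ y₁, y₂`; suppose `det F ≠ 0` at `a` and on `[X₁, ∞)`, `det F` has an ODD
  number of roots (with multiplicity) in `(a, X₁)`; `det G ≠ 0` on `(0, X₁]` and on `[X₂, ∞)` with an ODD number of roots in
  `(X₁, X₂)`; and the diagonal entry `G i i` is positive at `y₁` and negative at `y₂`.  THEN either `ν(F(a)) = 0` and
  `ν(F(x)) ≤ 1` for every `x > 0`, or `ν(F(a)) = 3` and `ν(F(x)) ≥ 2` for every `x > 0`.  PROOF: parity of the inertia walk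
  (`Inertia.even_negIndex_add_negIndex_add_card_roots`) across the two odd windows, constancy on the root-free windows, and the
  static inclusion principle `ν(G) ≤ ν(F) ≤ ν(G) + 1`, `ν(g) ≤ ν(G) ≤ ν(g) + 1` (`DefiniteMoments.negIndex_submatrix_interlace`);
* `posDef_of_negIndex_eq_zero` and the packaged form **`flag_inertia_law_posDef`**: in the first case `F(a) ≻ 0`, in the second
  `−F(a) ≻ 0` — a `(5,2)`-flagged nine-row (indeed any pencil with such an end) has a DEFINITE letter-side and its `det`-roots all
  lie on ONE eigenvalue branch (`λ_min`, resp. `λ_max`): walk `0101…` / `3232…`.  The census of record (theory g3 INERTIA-WALK,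
  `3-3.jsonl`): all `37` one-branch nine-rows are MIDDLE-branch (`1212…`/`2121…`), none of the forced type — consistent with
  j172323's empty return, and reducing PRED-T5 («does the m = 3 twin of SS-14 exist?») to «does a one-branch-from-definite
  `(3,3)` nine-row exist?» (seat report DOOR-A34-P3G15-REPORT: located maximum `7`).

[folklore] Sylvester inertia / Cauchy interlacing bookkeeping (Horn–Johnson §4.3); axioms standard; no definitions.
-/

-- layout Summits/ValiantsHypothesis/ValiantsHypothesis forces the duplicated namespace component
set_option linter.dupNamespace false

namespace Summit.ValiantsHypothesis.ValiantsHypothesis.Theorems.LacunarySymmetroidMatrixDescartes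

open Polynomial Matrix Finset
open scoped BigOperators

namespace Census

namespace FlagInertia

variable {ι : Type} [Fintype ι] [DecidableEq ι] {κ : Type} [Fintype κ]

/-! ## §1 Constancy on root-free closed windows, one-vector Rayleigh bounds, definiteness from the index -/

/-- **Constancy on a root-free closed window.**  If `det F(x) ≠ 0` for every `x ∈ [a, b]`, then `ν(F(b)) = ν(F(a))`. [folklore] -/
theorem negIndex_eq_of_det_ne_zero_Icc (d : κ → ℕ) (S : κ → Matrix ι ι ℝ) (hS : ∀ k, (S k).IsSymm) {a b : ℝ}
    (hab : a ≤ b) (hno : ∀ x ∈ Set.Icc a b, (∑ k, x ^ d k • S k).det ≠ 0) :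
    Fintype.card {j // (Inertia.isHermitian_pencil d S hS b).eigenvalues j < 0}
      = Fintype.card {j // (Inertia.isHermitian_pencil d S hS a).eigenvalues j < 0} := by
  classical
  have h := Inertia.negIndex_dist_le_sum_corank (fun x => ∑ k, x ^ d k • S k) (Inertia.continuous_pencil_entry d S)
    (Inertia.isHermitian_pencil d S hS) (∅ : Finset ℝ) hab (fun x hx h0 => absurd h0 (hno x hx))
    (hno a ⟨le_rfl, hab⟩) (hno b ⟨hab, le_rfl⟩)
  simp only [Finset.filter_empty, Finset.sum_empty, add_zero] at h
  exact le_antisymm h.1 h.2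

omit [Fintype κ] in
/-- **A negative diagonal entry is a negative Rayleigh vector**: `A i i < 0 ⇒ 1 ≤ ν(A)`. [folklore] -/
theorem one_le_negIndex_of_diag_neg {A : Matrix ι ι ℝ} (hA : A.IsHermitian) (i : ι) (hi : A i i < 0) :
    1 ≤ Fintype.card {j // hA.eigenvalues j < 0} := by
  have h := Inertia.card_le_negIndex hA (α := Unit) (fun _ => Pi.single i (1 : ℝ)) (fun c hc => by
    have hc0 : c () ≠ 0 := fun h0 => hc (funext fun u => by cases u; simpa using h0)
    have hsum : (∑ u : Unit, c u • (fun _ : Unit => Pi.single i (1 : ℝ)) u) = c () • Pi.single i (1 : ℝ) := by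
      simp
    rw [hsum, Matrix.mulVec_smul, dotProduct_smul, smul_dotProduct, Matrix.mulVec_single_one, single_dotProduct,
      one_mul, Matrix.col_apply, smul_eq_mul, smul_eq_mul]
    have : 0 < c () * c () := mul_self_pos.2 hc0
    nlinarith)
  simpa using h

omit [Fintype κ] in
/-- **A positive diagonal entry is a positive Rayleigh vector**: `0 < A i i ⇒ ν(A) + 1 ≤ card ι`. [folklore] -/
theorem negIndex_add_one_le_card_of_diag_pos {A : Matrix ι ι ℝ} (hA : A.IsHermitian) (i : ι) (hi : 0 < A i i) :
    Fintype.card {j // hA.eigenvalues j < 0} + 1 ≤ Fintype.card ι := by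
  have h := Inertia.card_le_posIndex hA (α := Unit) (fun _ => Pi.single i (1 : ℝ)) (fun c hc => by
    have hc0 : c () ≠ 0 := fun h0 => hc (funext fun u => by cases u; simpa using h0)
    have hsum : (∑ u : Unit, c u • (fun _ : Unit => Pi.single i (1 : ℝ)) u) = c () • Pi.single i (1 : ℝ) := by
      simp
    rw [hsum, Matrix.mulVec_smul, dotProduct_smul, smul_dotProduct, Matrix.mulVec_single_one, single_dotProduct,
      one_mul, Matrix.col_apply, smul_eq_mul, smul_eq_mul]
    have : 0 < c () * c () := mul_self_pos.2 hc0
    nlinarith)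
  have hc := (Inertia.negIndex_add_posIndex_add_corank hA).1
  simp only [Fintype.card_unit] at h
  omega

omit [Fintype κ] in
/-- **Definiteness from the index**: `ν(A) = 0` and `det A ≠ 0` give `A ≻ 0`. [folklore] -/
theorem posDef_of_negIndex_eq_zero {A : Matrix ι ι ℝ} (hA : A.IsHermitian)
    (hν : Fintype.card {j // hA.eigenvalues j < 0} = 0) (hdet : A.det ≠ 0) : A.PosDef := by
  rw [hA.posDef_iff_eigenvalues_pos]
  intro i
  have hne : hA.eigenvalues i ≠ 0 := by
    intro h0
    apply hdet
    rw [hA.det_eq_prod_eigenvalues]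
    exact_mod_cast Finset.prod_eq_zero (Finset.mem_univ i) (by simp [h0])
  rcases lt_trichotomy (hA.eigenvalues i) 0 with hlt | heq | hgt
  · have hpos : 0 < Fintype.card {j // hA.eigenvalues j < 0} :=
      Fintype.card_pos_iff.2 ⟨(⟨i, hlt⟩ : {j // hA.eigenvalues j < 0})⟩
    omega
  · exact absurd heq hne
  · exact hgt

/-! ## §2 The flag inertia law (size `3`, any letters and exponents) -/

section Flag

variable (d : κ → ℕ) (S : κ → Matrix (Fin 3) (Fin 3) ℝ) (hS : ∀ k, (S k).IsSymm)

/-- **THE FLAG INERTIA LAW.**  See the module docstring: an odd, detached window of `det F[e,e]`-roots beyond the roots of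
`det F`, followed by a sign change of the diagonal entry `F[e,e] i i` beyond those, forces `ν(F(a)) = 0` with `ν(F) ≤ 1`
everywhere on `(0, ∞)`, or `ν(F(a)) = 3` with `ν(F) ≥ 2` everywhere. [folklore] -/
theorem flag_inertia_law (e : Fin 2 → Fin 3) (he : Function.Injective e) (i : Fin 2)
    {a X₁ X₂ y₁ y₂ : ℝ} (ha : 0 < a) (haX : a < X₁) (hX : X₁ < X₂) (hy₁ : X₂ ≤ y₁) (hy₂ : X₂ ≤ y₂)
    (hFa : (∑ k, a ^ d k • S k).det ≠ 0)
    (hF₁ : ∀ x, X₁ ≤ x → (∑ k, x ^ d k • S k).det ≠ 0)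
    (hFodd : Odd (Multiset.card ((Matrix.det (∑ k, ((X : ℝ[X]) ^ d k) • (S k).map C)).roots.filter
      (fun t => a < t ∧ t < X₁))))
    (hG₀ : ∀ x, 0 < x → x ≤ X₁ → (∑ k, x ^ d k • (S k).submatrix e e).det ≠ 0)
    (hG₂ : ∀ x, X₂ ≤ x → (∑ k, x ^ d k • (S k).submatrix e e).det ≠ 0)
    (hGodd : Odd (Multiset.card ((Matrix.det (∑ k, ((X : ℝ[X]) ^ d k) • ((S k).submatrix e e).map C)).roots.filter
      (fun t => X₁ < t ∧ t < X₂))))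
    (hg₁ : 0 < (∑ k, y₁ ^ d k • (S k).submatrix e e) i i)
    (hg₂ : (∑ k, y₂ ^ d k • (S k).submatrix e e) i i < 0) :
    (Fintype.card {j // (Inertia.isHermitian_pencil d S hS a).eigenvalues j < 0} = 0 ∧
      ∀ x, 0 < x → Fintype.card {j // (Inertia.isHermitian_pencil d S hS x).eigenvalues j < 0} ≤ 1) ∨
    (Fintype.card {j // (Inertia.isHermitian_pencil d S hS a).eigenvalues j < 0} = 3 ∧
      ∀ x, 0 < x → 2 ≤ Fintype.card {j // (Inertia.isHermitian_pencil d S hS x).eigenvalues j < 0}) := by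
  classical
  -- the compressed pencil `G = F[e,e]`
  have hS' : ∀ k, ((fun k => (S k).submatrix e e) k).IsSymm := fun k => (hS k).submatrix e
  -- the two index functions
  let νF : ℝ → ℕ := fun x => Fintype.card {j // (Inertia.isHermitian_pencil d S hS x).eigenvalues j < 0}
  let νG : ℝ → ℕ := fun x =>
    Fintype.card {j // (Inertia.isHermitian_pencil d (fun k => (S k).submatrix e e) hS' x).eigenvalues j < 0}
  -- (1) interlacing at every scale: νG x ≤ νF x ≤ νG x + 1
  have hinter : ∀ x, νG x ≤ νF x ∧ νF x ≤ νG x + 1 := fun x => by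
    have h := DefiniteMoments.negIndex_submatrix_interlace d S hS e he x
    simp only [Fintype.card_fin] at h
    exact h
  -- (2) νF is constant on [X₁, ∞)
  have hFconst : ∀ x, X₁ ≤ x → νF x = νF X₁ := fun x hx =>
    negIndex_eq_of_det_ne_zero_Icc d S hS hx fun t ht => hF₁ t ht.1
  -- (3) νG is constant on (0, X₁] and on [X₂, ∞)
  have hGconst₀ : ∀ x, 0 < x → x ≤ X₁ → νG X₁ = νG x := fun x hx hxX =>
    negIndex_eq_of_det_ne_zero_Icc d (fun k => (S k).submatrix e e) hS' hxX
      fun t ht => hG₀ t (lt_of_lt_of_le hx ht.1) ht.2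
  have hGconst₂ : ∀ x, X₂ ≤ x → νG x = νG X₂ := fun x hx =>
    negIndex_eq_of_det_ne_zero_Icc d (fun k => (S k).submatrix e e) hS' hx fun t ht => hG₂ t ht.1
  -- (4) parity across the two odd windows
  have hGpar : Even (νG X₁ + νG X₂ + Multiset.card ((Matrix.det (∑ k, ((X : ℝ[X]) ^ d k) •
      ((S k).submatrix e e).map C)).roots.filter (fun t => X₁ < t ∧ t < X₂))) :=
    Inertia.even_negIndex_add_negIndex_add_card_roots d (fun k => (S k).submatrix e e) hS' hX.le
      (hG₀ X₁ (lt_trans ha haX) le_rfl) (hG₂ X₂ le_rfl)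
  have hFpar : Even (νF a + νF X₁ + Multiset.card ((Matrix.det (∑ k, ((X : ℝ[X]) ^ d k) • (S k).map C)).roots.filter
      (fun t => a < t ∧ t < X₁))) :=
    Inertia.even_negIndex_add_negIndex_add_card_roots d S hS haX.le hFa (hF₁ X₁ le_rfl)
  -- (5) the diagonal entry pins νG on [X₂, ∞) to 1
  have hGy₁ : νG y₁ + 1 ≤ 2 := by
    have h := negIndex_add_one_le_card_of_diag_pos
      (Inertia.isHermitian_pencil d (fun k => (S k).submatrix e e) hS' y₁) i hg₁
    simp only [Fintype.card_fin] at h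
    exact h
  have hGy₂ : 1 ≤ νG y₂ :=
    one_le_negIndex_of_diag_neg (Inertia.isHermitian_pencil d (fun k => (S k).submatrix e e) hS' y₂) i hg₂
  have hG1 : νG X₂ = 1 := by
    have e1 : νG y₁ = νG X₂ := hGconst₂ y₁ hy₁
    have e2 : νG y₂ = νG X₂ := hGconst₂ y₂ hy₂
    omega
  -- (6) bookkeeping
  have hνa3 : νF a ≤ 3 := by
    have h := Fintype.card_subtype_le (fun j => (Inertia.isHermitian_pencil d S hS a).eigenvalues j < 0)
    simp only [Fintype.card_fin] at h
    exact h
  have hiX₁ : νG X₁ ≤ νF X₁ ∧ νF X₁ ≤ νG X₁ + 1 := hinter X₁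
  have hiX₂ : νG X₂ ≤ νF X₂ ∧ νF X₂ ≤ νG X₂ + 1 := hinter X₂
  have hia : νG a ≤ νF a ∧ νF a ≤ νG a + 1 := hinter a
  have hFX₂ : νF X₂ = νF X₁ := hFconst X₂ hX.le
  have hGa : νG X₁ = νG a := hGconst₀ a ha haX.le
  obtain ⟨m, hm⟩ := hGodd
  obtain ⟨n, hn⟩ := hFodd
  rw [hm] at hGpar
  rw [hn] at hFpar
  obtain ⟨p, hp⟩ := hGpar
  obtain ⟨q, hq⟩ := hFpar
  -- case split on νG X₁ ∈ {0, 2}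
  have hcases : (νG X₁ = 0 ∧ νF X₁ = 1) ∨ (νG X₁ = 2 ∧ νF X₁ = 2) := by omega
  rcases hcases with ⟨hG0, hF1⟩ | ⟨hG2, hF2⟩
  · left
    refine ⟨?_, fun x hx => ?_⟩
    · show νF a = 0
      omega
    · show νF x ≤ 1
      rcases le_or_gt x X₁ with hxle | hxgt
      · have h1 : νG X₁ = νG x := hGconst₀ x hx hxle
        have h2 : νG x ≤ νF x ∧ νF x ≤ νG x + 1 := hinter x
        omega
      · have h1 : νF x = νF X₁ := hFconst x hxgt.le
        omega
  · right
    refine ⟨?_, fun x hx => ?_⟩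
    · show νF a = 3
      omega
    · show 2 ≤ νF x
      rcases le_or_gt x X₁ with hxle | hxgt
      · have h1 : νG X₁ = νG x := hGconst₀ x hx hxle
        have h2 : νG x ≤ νF x ∧ νF x ≤ νG x + 1 := hinter x
        omega
      · have h1 : νF x = νF X₁ := hFconst x hxgt.le
        omega

/-- **THE FLAG INERTIA LAW, definiteness form.**  Under the hypotheses of `flag_inertia_law`, the scale `a` (below the odd
window of `det F`) carries a DEFINITE matrix: `F(a) ≻ 0` with `ν(F) ≤ 1` on `(0,∞)`, or `−F(a) ≻ 0` with `ν(F) ≥ 2` on `(0,∞)`.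
In particular a real symmetric `(3,3)` nine-row with a fully external `(5,2)` flag at one end is ONE-BRANCH FROM A DEFINITE END. [folklore] -/
theorem flag_inertia_law_posDef (e : Fin 2 → Fin 3) (he : Function.Injective e) (i : Fin 2)
    {a X₁ X₂ y₁ y₂ : ℝ} (ha : 0 < a) (haX : a < X₁) (hX : X₁ < X₂) (hy₁ : X₂ ≤ y₁) (hy₂ : X₂ ≤ y₂)
    (hFa : (∑ k, a ^ d k • S k).det ≠ 0)
    (hF₁ : ∀ x, X₁ ≤ x → (∑ k, x ^ d k • S k).det ≠ 0)
    (hFodd : Odd (Multiset.card ((Matrix.det (∑ k, ((X : ℝ[X]) ^ d k) • (S k).map C)).roots.filter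
      (fun t => a < t ∧ t < X₁))))
    (hG₀ : ∀ x, 0 < x → x ≤ X₁ → (∑ k, x ^ d k • (S k).submatrix e e).det ≠ 0)
    (hG₂ : ∀ x, X₂ ≤ x → (∑ k, x ^ d k • (S k).submatrix e e).det ≠ 0)
    (hGodd : Odd (Multiset.card ((Matrix.det (∑ k, ((X : ℝ[X]) ^ d k) • ((S k).submatrix e e).map C)).roots.filter
      (fun t => X₁ < t ∧ t < X₂))))
    (hg₁ : 0 < (∑ k, y₁ ^ d k • (S k).submatrix e e) i i)
    (hg₂ : (∑ k, y₂ ^ d k • (S k).submatrix e e) i i < 0) :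
    ((∑ k, a ^ d k • S k).PosDef ∧
      ∀ x, 0 < x → Fintype.card {j // (Inertia.isHermitian_pencil d S hS x).eigenvalues j < 0} ≤ 1) ∨
    ((-(∑ k, a ^ d k • S k)).PosDef ∧
      ∀ x, 0 < x → 2 ≤ Fintype.card {j // (Inertia.isHermitian_pencil d S hS x).eigenvalues j < 0}) := by
  classical
  rcases flag_inertia_law d S hS e he i ha haX hX hy₁ hy₂ hFa hF₁ hFodd hG₀ hG₂ hGodd hg₁ hg₂ with ⟨h0, h1⟩ | ⟨h3, h2⟩
  · exact Or.inl ⟨posDef_of_negIndex_eq_zero _ h0 hFa, h1⟩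
  · right
    refine ⟨?_, h2⟩
    -- the negated pencil has index 0 at `a`
    have hSn : ∀ k, (-S k).IsSymm := fun k => (hS k).neg
    have hneg : (∑ k, a ^ d k • (-S k)) = -(∑ k, a ^ d k • S k) := by
      rw [← Finset.sum_neg_distrib]; exact Finset.sum_congr rfl fun k _ => smul_neg _ _
    have hH := Inertia.isHermitian_pencil d (fun k => -S k) hSn a
    have hdetn : (∑ k, a ^ d k • (-S k)).det ≠ 0 := by
      rw [hneg, Matrix.det_neg]; exact mul_ne_zero (pow_ne_zero _ (by norm_num)) hFa
    -- ν(−A) = π(A) = 3 − ν(A) − corank = 0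
    have hc := (Inertia.negIndex_add_posIndex_add_corank (Inertia.isHermitian_pencil d S hS a)).1
    have hcor : Fintype.card (Fin 3) - (∑ k, a ^ d k • S k).rank = 0 := Inertia.corank_eq_zero_of_det_ne_zero hFa
    have hπ : Fintype.card {j // 0 < (Inertia.isHermitian_pencil d S hS a).eigenvalues j} = 0 := by
      simp only [Fintype.card_fin] at hc hcor; omega
    have hνn : Fintype.card {j // hH.eigenvalues j < 0} = 0 := by
      have key := Inertia.posIndex_eq_negIndex_neg (Inertia.isHermitian_pencil d S hS a)
        ((Inertia.isHermitian_pencil d S hS a).neg)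
      have hH' : (-(∑ k, a ^ d k • S k)).IsHermitian := (Inertia.isHermitian_pencil d S hS a).neg
      have e2 : Fintype.card {j // hH.eigenvalues j < 0} = Fintype.card {j // hH'.eigenvalues j < 0} := by
        have := DefiniteMoments.negIndex_congr hH hH' hneg
        exact this
      rw [e2, ← key]; exact hπ
    have := posDef_of_negIndex_eq_zero hH hνn hdetn
    rwa [hneg] at this

end Flag

/-! ## §3 (appended, val-sym-door-p3 g15) No such flag at a letter-side that is INDEFINITE — the census nine-rows are excluded by their end letter alone -/

/-- **Negative definiteness from the index**: `ν(A) = 3` and `det A ≠ 0` give `−A ≻ 0` (size `3`). [folklore] -/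
theorem posDef_neg_of_negIndex_eq_three {A : Matrix (Fin 3) (Fin 3) ℝ} (hA : A.IsHermitian)
    (hν : Fintype.card {j // hA.eigenvalues j < 0} = 3) (hdet : A.det ≠ 0) : (-A).PosDef := by
  classical
  have hA' : (-A).IsHermitian := hA.neg
  have hc := (Inertia.negIndex_add_posIndex_add_corank hA).1
  have hcor : Fintype.card (Fin 3) - A.rank = 0 := Inertia.corank_eq_zero_of_det_ne_zero hdet
  have hπ : Fintype.card {j // 0 < hA.eigenvalues j} = 0 := by
    simp only [Fintype.card_fin] at hc hcor; omega
  have hνn : Fintype.card {j // hA'.eigenvalues j < 0} = 0 := by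
    rw [← Inertia.posIndex_eq_negIndex_neg hA hA']; exact hπ
  have hdetn : (-A).det ≠ 0 := by
    rw [Matrix.det_neg]; exact mul_ne_zero (pow_ne_zero _ (by norm_num)) hdet
  exact posDef_of_negIndex_eq_zero hA' hνn hdetn

/-- The pencil at the scale `0` is the letter carried by the exponent `0` (all other exponents positive). [folklore] -/
theorem pencil_eval_zero {κ : Type} [Fintype κ] [DecidableEq κ] (d : κ → ℕ) (S : κ → Matrix (Fin 3) (Fin 3) ℝ) (l₀ : κ)
    (hd0 : d l₀ = 0) (hdl : ∀ l, l ≠ l₀ → 0 < d l) :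
    (∑ k, (0 : ℝ) ^ d k • S k) = S l₀ := by
  rw [Finset.sum_eq_single l₀]
  · rw [hd0, pow_zero, one_smul]
  · intro l _ hl
    rw [zero_pow (Nat.pos_iff_ne_zero.1 (hdl l hl)), zero_smul]
  · intro h; exact absurd (Finset.mem_univ l₀) h

/-- **NO FLAG AT AN INDEFINITE LETTER-SIDE.**  Let the exponent `0` be carried by exactly one letter `S l₀`, NONSINGULAR AND INDEFINITE (the
situation of every `(3,3)` nine-row of the census: both end letters indefinite).  Then the flag configuration of `flag_inertia_law` — `det F ≠ 0`
on `[0, a]` and on `[X₁, ∞)` with an odd number of roots in `(a, X₁)`, an odd detached window of `det F[e,e]`-roots in `(X₁, X₂)`, and a sign change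
of the diagonal entry `F[e,e] i i` beyond `X₂` — is IMPOSSIBLE.  In the cell's language: a `(5,2)`-flag (indeed any (odd, sign-changing) flag) needs a
DEFINITE letter at the opposite end; the flag ladder cannot be fed by any both-ends-indefinite nine-row. [folklore] -/
theorem no_flag_of_indefinite_letter {κ : Type} [Fintype κ] [DecidableEq κ] (d : κ → ℕ) (S : κ → Matrix (Fin 3) (Fin 3) ℝ)
    (hS : ∀ k, (S k).IsSymm) (l₀ : κ) (hd0 : d l₀ = 0) (hdl : ∀ l, l ≠ l₀ → 0 < d l)
    (hdet0 : (S l₀).det ≠ 0) (hindef : ¬ (S l₀).PosDef) (hindef' : ¬ (-(S l₀)).PosDef)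
    (e : Fin 2 → Fin 3) (he : Function.Injective e) (i : Fin 2)
    {a X₁ X₂ y₁ y₂ : ℝ} (ha : 0 < a) (haX : a < X₁) (hX : X₁ < X₂) (hy₁ : X₂ ≤ y₁) (hy₂ : X₂ ≤ y₂)
    (hF₀ : ∀ x, 0 ≤ x → x ≤ a → (∑ k, x ^ d k • S k).det ≠ 0)
    (hF₁ : ∀ x, X₁ ≤ x → (∑ k, x ^ d k • S k).det ≠ 0)
    (hFodd : Odd (Multiset.card ((Matrix.det (∑ k, ((X : ℝ[X]) ^ d k) • (S k).map C)).roots.filter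
      (fun t => a < t ∧ t < X₁))))
    (hG₀ : ∀ x, 0 < x → x ≤ X₁ → (∑ k, x ^ d k • (S k).submatrix e e).det ≠ 0)
    (hG₂ : ∀ x, X₂ ≤ x → (∑ k, x ^ d k • (S k).submatrix e e).det ≠ 0)
    (hGodd : Odd (Multiset.card ((Matrix.det (∑ k, ((X : ℝ[X]) ^ d k) • ((S k).submatrix e e).map C)).roots.filter
      (fun t => X₁ < t ∧ t < X₂))))
    (hg₁ : 0 < (∑ k, y₁ ^ d k • (S k).submatrix e e) i i)
    (hg₂ : (∑ k, y₂ ^ d k • (S k).submatrix e e) i i < 0) : False := by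
  classical
  -- the index is constant on `[0, a]`, and the pencil at `0` is `S l₀`
  have hconst : Fintype.card {j // (Inertia.isHermitian_pencil d S hS a).eigenvalues j < 0}
      = Fintype.card {j // (Inertia.isHermitian_pencil d S hS 0).eigenvalues j < 0} :=
    negIndex_eq_of_det_ne_zero_Icc d S hS ha.le fun t ht => hF₀ t ht.1 ht.2
  have h0 : (∑ k, (0 : ℝ) ^ d k • S k) = S l₀ := pencil_eval_zero d S l₀ hd0 hdl
  have hH0 : (S l₀).IsHermitian := Inertia.isHermitian_of_isSymm (hS l₀)
  have htr : Fintype.card {j // (Inertia.isHermitian_pencil d S hS 0).eigenvalues j < 0}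
      = Fintype.card {j // hH0.eigenvalues j < 0} := DefiniteMoments.negIndex_congr _ hH0 h0
  rcases flag_inertia_law d S hS e he i ha haX hX hy₁ hy₂ (hF₀ a ha.le le_rfl) hF₁ hFodd hG₀ hG₂ hGodd hg₁ hg₂ with
    ⟨hν0, -⟩ | ⟨hν3, -⟩
  · rw [hconst, htr] at hν0
    exact hindef (posDef_of_negIndex_eq_zero hH0 hν0 hdet0)
  · rw [hconst, htr] at hν3
    exact hindef' (posDef_neg_of_negIndex_eq_three hH0 hν3 hdet0)

end FlagInertia

end Census

end Summit.ValiantsHypothesis.ValiantsHypothesis.Theorems.LacunarySymmetroidMatrixDescartes
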